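import Summits.ResolutionOfSingularities.ResolutionOfSingularities.Theorems.FrobeniusLadderFRationalModificationDeformFW
import HarnessLib

/-!
# Fedder–Watanabe deformation of tight closedness, pointwise test exponent
(crux `FrobeniusLadder.FRationalModification`)

Stub `stub_deformFWPointwise` of the skeleton `Sketch` (v8) for crux
stmt-ResolutionOfSingularities-15316 (route `ResolutionOfSingularities/FrobeniusLadder`, rung 3:
F-rational models) — Fedder–Watanabe 1989, Prop. 2.13, with a POINTWISE test exponent.

Let `(R, 𝔪)` be a Noetherian local domain of prime characteristic `p` and dimension `d + 1` in
which every system of parameters is a weakly regular sequence (Cohen–Macaulay). Let `f ∈ R` and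
`s : Fin d → R` with `rad (f, s) = 𝔪`, such that

* `R/fR` is F-injective at `s`, written upstairs: `y^q ∈ (f) + (s)^[q] ⇒ y ∈ (f, s)` (`q = p^e`);
* for every `y` and every witness `c ≠ 0` of `y ∈ (f, s)^*` (`c y^q ∈ (f, s)^[q]` for all `q`)
  there is an exponent `n` (depending on `y`, `c`) with `fⁿ y^q ∈ (f^q, s₁^q, …, s_d^q)` for ALL
  `q = p^e`.

Then the parameter ideal `(f, s)` is tightly closed.

Proof. For `y ∈ (f, s)^*` with witness `c`, take the exponent `n` handed by the hypothesis,
replace it by `n + 1 ≥ 1`, and pick `q = p^e > n`, `q = n + k + 1`. Then `fⁿ y^q = a f^q + b` with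
`b ∈ (s^q)`, so `fⁿ (y^q - a f^{k+1}) = b ∈ (s^q)`; as `(s^q, fⁿ)` is a system of parameters, hence
weakly regular, `fⁿ` is a non-zero-divisor modulo `(s^q)` (colon capturing,
`Exchange.mem_span_of_mul_mem`), so `y^q - a f^{k+1} ∈ (s)^[q]` and `y^q ∈ (f) + (s)^[q]`;
F-injectivity gives `y ∈ (f, s)`.

This is the landed `DeformFW.stub_deformFW` (one exponent `n` for all parameter ideals) with the
single use of the test element replaced by the pointwise hypothesis; the helper
`DeformFW.radical_span_insert_pow` and the colon-capturing lemma `Exchange.mem_span_of_mul_mem` are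
reused from the sibling support files. No named facts.

Reference: R. Fedder, K.-i. Watanabe, *A characterization of F-regularity in terms of F-purity*,
in: Commutative Algebra (MSRI Publ. 15), Springer 1989, 227–245, Prop. 2.13.
-/

-- single-problem summit: the doubled namespace component `ResolutionOfSingularities` is forced
set_option linter.dupNamespace false

namespace Summit.ResolutionOfSingularities.ResolutionOfSingularities.Theorems.FRationalModification.DeformFWPointwise

open IsLocalRing RingTheory.Sequence Literature.RingTheory.TightClosure

/-- **Fedder–Watanabe 1989, Prop. 2.13 with a pointwise test exponent** — stub
`stub_deformFWPointwise` of crux `FRationalModification`, line `Sketch`: `(R, 𝔪)` a Noetherian local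
domain of characteristic `p` and dimension `d + 1` in which every system of parameters is a weakly
regular sequence; `(f, s)` a parameter ideal (`rad (f, s) = 𝔪`) such that `R/fR` is F-injective at
`s`, written upstairs (`y^q ∈ (f) + (s)^[q] ⇒ y ∈ (f, s)`); and for every `y` and every witness
`c ≠ 0` of `y ∈ (f, s)^*` (`c y^q ∈ (f, s)^[q]` for all `q`) there is an exponent `n` with
`fⁿ y^q ∈ (f^q, s₁^q, …, s_d^q)` for ALL `q = p^e`. Then `(f, s)` is tightly closed: for such `y`,
bump `n` to `n + 1 ≥ 1` and pick `q > n`; `fⁿ y^q = a f^q + b`, `b ∈ (s)^[q]`;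
`fⁿ (y^q − a f^{q−n}) ∈ (s)^[q]` and `fⁿ` is regular modulo `(s)^[q]` (the system of parameters
`s^q, fⁿ` is weakly regular), so `y^q ∈ (f) + (s)^[q]`, whence `y ∈ (f, s)` by F-injectivity.
[cite: FedderWatanabe1989, Prop. 2.13] -/
theorem stub_deformFWPointwise (p : ℕ) [Fact p.Prime] {R : Type*} [CommRing R] [IsDomain R]
    [IsNoetherianRing R] [IsLocalRing R] [CharP R p]
    (hCM : ∀ ⦃n : ℕ⦄ (s : Fin n → R), IsSystemOfParameters s → IsWeaklyRegular R (List.ofFn s))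
    {d : ℕ} (hd : ringKrullDim R = ((d + 1 : ℕ) : WithBot ℕ∞)) {f : R} {s : Fin d → R}
    (hs : (Ideal.span (insert f (Set.range s))).radical = maximalIdeal R)
    (hFinj : ∀ (y : R) (e : ℕ),
      y ^ p ^ e ∈ Ideal.span {f} ⊔ frobeniusPower (p ^ e) (Ideal.span (Set.range s)) →
        y ∈ Ideal.span (insert f (Set.range s)))
    (htest : ∀ y c : R, c ≠ 0 →
      (∀ e : ℕ, c * y ^ p ^ e ∈ frobeniusPower (p ^ e) (Ideal.span (insert f (Set.range s)))) →
      ∃ n : ℕ, ∀ e : ℕ, f ^ n * y ^ p ^ e ∈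
        Ideal.span (insert (f ^ p ^ e) (Set.range fun i => s i ^ p ^ e))) :
    IsTightlyClosed p (Ideal.span (insert f (Set.range s))) := by
  have hp : p.Prime := Fact.out
  rw [isTightlyClosed_iff_le]
  intro y hy
  obtain ⟨c, hc, hcy⟩ := (mem_tightClosure_iff_of_isDomain p).mp hy
  -- (0) a pointwise test exponent `n ≥ 1` for `y`, `c`
  obtain ⟨n, hn, hn'⟩ : ∃ n : ℕ, 0 < n ∧ ∀ e : ℕ, f ^ n * y ^ p ^ e ∈
      Ideal.span (insert (f ^ p ^ e) (Set.range fun i => s i ^ p ^ e)) := by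
    obtain ⟨n₀, hn₀⟩ := htest y c hc hcy
    refine ⟨n₀ + 1, n₀.succ_pos, fun e => ?_⟩
    rw [pow_succ', mul_assoc]
    exact Ideal.mul_mem_left _ f (hn₀ e)
  -- `q = p ^ e > n`, `q = n + k + 1`
  obtain ⟨e, hne⟩ : ∃ e : ℕ, n < p ^ e := ⟨n, Nat.lt_pow_self hp.one_lt⟩
  obtain ⟨k, hk⟩ := Nat.exists_eq_add_of_lt hne
  have hq : 0 < p ^ e := pow_pos hp.pos e
  -- (i)–(ii) the pointwise test exponent: `fⁿ y^q = a f^q + b`, `b ∈ (s^q)`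
  have h2 := hn' e
  rw [Ideal.mem_span_insert] at h2
  obtain ⟨a, b, hb, hab⟩ := h2
  -- (iii) `fⁿ (y^q - a f^(q-n)) = b ∈ (s^q)`
  have hfq : f ^ p ^ e = f ^ n * f ^ (k + 1) := by
    rw [hk, add_assoc, pow_add]
  have hz : f ^ n * (y ^ p ^ e - a * f ^ (k + 1)) = b := by
    rw [mul_sub, hab, hfq]
    ring
  -- (iv) colon capturing: `fⁿ` is regular modulo `(s^q)` as `(s^q, fⁿ)` is a weakly regular s.o.p.
  have hw : (Ideal.span (insert (f ^ n) (Set.range fun i => s i ^ p ^ e))).radical =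
      maximalIdeal R := by
    rw [DeformFW.radical_span_insert_pow f s hn hq, hs]
  have hzmem : y ^ p ^ e - a * f ^ (k + 1) ∈ Ideal.span (Set.range fun i => s i ^ p ^ e) :=
    Exchange.mem_span_of_mul_mem hCM hd hw (by rw [hz]; exact hb)
  -- (v) `y^q ∈ (f) + (s)^[q]`, so `y ∈ (f, s)` by F-injectivity
  have hsq : frobeniusPower (p ^ e) (Ideal.span (Set.range s)) =
      Ideal.span (Set.range fun i => s i ^ p ^ e) := by
    rw [frobeniusPower_span, ← Set.range_comp]
    rfl
  refine hFinj y e ?_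
  have hy_eq : y ^ p ^ e = a * f ^ k * f + (y ^ p ^ e - a * f ^ (k + 1)) := by ring
  rw [hy_eq, hsq]
  exact Submodule.add_mem_sup (Ideal.mul_mem_left _ _ (Ideal.mem_span_singleton_self f)) hzmem

end Summit.ResolutionOfSingularities.ResolutionOfSingularities.Theorems.FRationalModification.DeformFWPointwise
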